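import Summits.NavierStokesRegularity.NavierStokesRegularity.Theses.SelfMixingDichotomy
import Summits.NavierStokesRegularity.NavierStokesRegularity.Theorems.SelfMixingDichotomyMixingPayoffReduction
import Summits.NavierStokesRegularity.NavierStokesRegularity.Theorems.SelfMixingDichotomyCoherentScaleExclusionNonMixingExclusion
import HarnessLib

/-!
# Route `SelfMixingDichotomy`: the thesis `X = P ∧ S2 ∧ S1` is `H ∧ NME` (two load-free statements)

Support file (`--supports stmt-NavierStokesRegularity-1423`, lead c1 of the line on the crux
`CoherentScaleExclusion`; pure logic over two landed reductions). The route's thesis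
`Thesis = MixingPayoff ∧ CoherentScaleExclusion ∧ SequentialTypeIExclusion` (bodies inlined) is, by

* `mixingPayoff_iff_mixingForcesTypeI` (line `birth` on `MixingPayoff`, stmt-1422): P ⇔ H, H := "there are absolute
  `δ, K > 0` such that a standing solution cofinally `δ`-mixing at `(T, x₀)` obeys the Type-I(K) bound
  `√(T − t)‖u(t,x)‖ ≤ K` on a parabolic cylinder at `(T, x₀)`", and
* `sequentialTypeIExclusion_and_coherentScaleExclusion_iff` (this line, stmt-1423): S1 ∧ S2 ⇔ NME, NME := "for every
  `δ > 0`, a standing solution recurrently NON-`δ`-mixing at `(T, x₀)` is bounded near `(T, x₀)`",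

equivalent to the conjunction of the two LOAD-FREE statements H ∧ NME
(`thesis_iff_mixingForcesTypeI_and_nonMixingExclusion`): the local Reynolds number `cknC`, the threshold `M` of S2 and
the whole Type-I-window crux S1 are bookkeeping. At a FIXED `δ` the split "cofinitely `δ`-mixing / recurrently
non-`δ`-mixing" is excluded middle, so `P(δ) ∧ NME(δ)` is exactly "every standing solution is bounded near every
final-time point" (`bdd_iff_mixingPayoff_at_and_nonMixingExclusion_at`): the route has no slack beyond the choice of
`δ` — all of its content is WHERE the line between the two halves is drawn (the mixing level `δ`, and on the mixing
side the Type-I constant `K` of H).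

Everything is unconditional (standard axioms); no definitions, no named facts.
-/

noncomputable section

-- `Summit = Problem` for this summit; the tree lakefile sets `weak.linter.dupNamespace = false`.
set_option linter.dupNamespace false

namespace Summit.NavierStokesRegularity.NavierStokesRegularity.Theorems

open MeasureTheory Set Metric
open Literature.Analysis.FluidPDE
open Summit.NavierStokesRegularity.NavierStokesRegularity.Theses.SelfMixingDichotomy

/-- **`Thesis ⇔ H ∧ NME`.** The thesis of route `SelfMixingDichotomy` (the conjunction P ∧ S2 ∧ S1 with the three crux
bodies inlined) is equivalent to the conjunction of the open heart H of `MixingPayoff` (cofinal `δ`-mixing forces a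
Type-I(K) bound, absolute `δ, K`) and the non-mixing exclusion NME (for every `δ > 0`, recurrently non-`δ`-mixing
final-time points of standing solutions are points of local boundedness): `mixingPayoff_iff_mixingForcesTypeI` and
`sequentialTypeIExclusion_and_coherentScaleExclusion_iff` combined (`Thesis` unfolds to
`MixingPayoff ∧ CoherentScaleExclusion ∧ SequentialTypeIExclusion` by `rfl`). -/
theorem thesis_iff_mixingForcesTypeI_and_nonMixingExclusion : Summit.NavierStokesRegularity.NavierStokesRegularity.Theses.SelfMixingDichotomy.Thesis ↔ ((∃ δ : ℝ, 0 < δ ∧ ∃ K : ℝ, 0 < K ∧ ∀ (T : ℝ) (u : ℝ → EuclideanSpace ℝ (Fin 3) → EuclideanSpace ℝ (Fin 3)) (p : ℝ → EuclideanSpace ℝ (Fin 3) → ℝ), 0 < T → Literature.Analysis.FluidPDE.IsClassicalNSSolutionOn (Set.Ico 0 T) 1 0 u p → Literature.Analysis.FluidPDE.IsLerayHopfOn T 1 0 (u 0) u → Literature.Analysis.FluidPDE.HasRapidSpatialDecay (u 0) → ∀ x₀ : EuclideanSpace ℝ (Fin 3), (∃ r₀ : ℝ, 0 < r₀ ∧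 ∀ r ∈ Set.Ioo 0 r₀, Literature.Analysis.FluidPDE.DissipatesAtScale u T x₀ r δ) → ∃ r₁ : ℝ, 0 < r₁ ∧ ∀ t ∈ Set.Ioo (T - r₁ ^ 2) T, ∀ x ∈ Metric.ball x₀ r₁, Real.sqrt (T - t) * ‖u t x‖ ≤ K) ∧ (∀ δ : ℝ, 0 < δ → ∀ T : ℝ, 0 < T → ∀ (u : ℝ → EuclideanSpace ℝ (Fin 3) → EuclideanSpace ℝ (Fin 3)) (p : ℝ → EuclideanSpace ℝ (Fin 3) → ℝ), Literature.Analysis.FluidPDE.IsClassicalNSSolutionOn (Set.Ico 0 T) 1 0 u p → Literature.Analysis.FluidPDE.IsLerayHopfOn T 1 0 (u 0) u → Literature.Analysis.FluidPDE.HasRapidSpatialDecay (u 0) → ∀ x₀ : EuclideanSpace ℝ (Fin 3), (∀ r₀ : ℝ, 0 < r₀ → ∃ r ∈ Set.Ioo 0 r₀, ¬ Literature.Analysis.FluidPDE.DissipatesAtScale u T x₀ r δ) → (∃ ρ : ℝ, 0 < ρ ∧ ∃ M : ℝ, ∀ t ∈ Set.Ioo (T - ρ ^ 2) T, ∀ x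 ∈ Metric.ball x₀ ρ, ‖u t x‖ ≤ M))) := by
  have hT : Thesis ↔ MixingPayoff ∧ CoherentScaleExclusion ∧ SequentialTypeIExclusion := Iff.rfl
  rw [hT, mixingPayoff_iff_mixingForcesTypeI, ← sequentialTypeIExclusion_and_coherentScaleExclusion_iff]
  exact ⟨fun ⟨hH, hS2, hS1⟩ => ⟨hH, hS1, hS2⟩, fun ⟨hH, hS1, hS2⟩ => ⟨hH, hS2, hS1⟩⟩

/-- **At a fixed `δ` the route is excluded middle.** For every `δ`, "cofinally `δ`-mixing final-time points of
standing solutions are bounded" AND "recurrently non-`δ`-mixing final-time points of standing solutions are bounded"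
hold together iff EVERY standing solution is bounded near EVERY final-time point (the antecedent of the route's
`LocalToGlobal`). So `P(δ) ∧ NME(δ)` has no slack: the content of the route is the placement of the mixing level `δ`
(and, inside P, the Type-I constant of H). -/
theorem bdd_iff_mixingPayoff_at_and_nonMixingExclusion_at (δ : ℝ) :
    (∀ T : ℝ, 0 < T → ∀ (u : ℝ → EuclideanSpace ℝ (Fin 3) → EuclideanSpace ℝ (Fin 3))
      (p : ℝ → EuclideanSpace ℝ (Fin 3) → ℝ),
      IsClassicalNSSolutionOn (Set.Ico 0 T) 1 0 u p → IsLerayHopfOn T 1 0 (u 0) u →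
      HasRapidSpatialDecay (u 0) → ∀ x₀ : EuclideanSpace ℝ (Fin 3),
      ∃ ρ : ℝ, 0 < ρ ∧ ∃ M : ℝ, ∀ t ∈ Set.Ioo (T - ρ ^ 2) T, ∀ x ∈ Metric.ball x₀ ρ, ‖u t x‖ ≤ M) ↔
    ((∀ T : ℝ, 0 < T → ∀ (u : ℝ → EuclideanSpace ℝ (Fin 3) → EuclideanSpace ℝ (Fin 3))
        (p : ℝ → EuclideanSpace ℝ (Fin 3) → ℝ),
        IsClassicalNSSolutionOn (Set.Ico 0 T) 1 0 u p → IsLerayHopfOn T 1 0 (u 0) u →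
        HasRapidSpatialDecay (u 0) → ∀ x₀ : EuclideanSpace ℝ (Fin 3),
        (∃ r₀ : ℝ, 0 < r₀ ∧ ∀ r ∈ Set.Ioo 0 r₀, DissipatesAtScale u T x₀ r δ) →
        ∃ ρ : ℝ, 0 < ρ ∧ ∃ M : ℝ, ∀ t ∈ Set.Ioo (T - ρ ^ 2) T, ∀ x ∈ Metric.ball x₀ ρ, ‖u t x‖ ≤ M) ∧
      (∀ T : ℝ, 0 < T → ∀ (u : ℝ → EuclideanSpace ℝ (Fin 3) → EuclideanSpace ℝ (Fin 3))
        (p : ℝ → EuclideanSpace ℝ (Fin 3) → ℝ),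
        IsClassicalNSSolutionOn (Set.Ico 0 T) 1 0 u p → IsLerayHopfOn T 1 0 (u 0) u →
        HasRapidSpatialDecay (u 0) → ∀ x₀ : EuclideanSpace ℝ (Fin 3),
        (∀ r₀ : ℝ, 0 < r₀ → ∃ r ∈ Set.Ioo 0 r₀, ¬ DissipatesAtScale u T x₀ r δ) →
        ∃ ρ : ℝ, 0 < ρ ∧ ∃ M : ℝ, ∀ t ∈ Set.Ioo (T - ρ ^ 2) T, ∀ x ∈ Metric.ball x₀ ρ, ‖u t x‖ ≤ M)) := by
  constructor
  · exact fun h => ⟨fun T hT u p hcl hLH hdec x₀ _ => h T hT u p hcl hLH hdec x₀,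
      fun T hT u p hcl hLH hdec x₀ _ => h T hT u p hcl hLH hdec x₀⟩
  · rintro ⟨hP, hN⟩ T hT u p hcl hLH hdec x₀
    by_cases hmix : ∃ r₀ : ℝ, 0 < r₀ ∧ ∀ r ∈ Set.Ioo 0 r₀, DissipatesAtScale u T x₀ r δ
    · exact hP T hT u p hcl hLH hdec x₀ hmix
    · refine hN T hT u p hcl hLH hdec x₀ fun r₀ hr₀ => ?_
      by_contra hall
      push Not at hall
      exact hmix ⟨r₀, hr₀, fun r hr => hall r hr⟩

end Summit.NavierStokesRegularity.NavierStokesRegularity.Theorems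

end
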